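import Mathlib
import Summits.Ventures.FusionMHD.Models.CerfonFreidbergIterLikeQHalfShearDefs
import HarnessLib

/-!
# Ventures/FusionMHD — Models/CerfonFreidbergIterLikeQHalfShearPanels1.lean: KERNEL CHECK of the shear-register certificates of panels 0, 1 (of 32)
# at `ψ_N = 1/2` of THE Cerfon–Freidberg ITER-like instance

HONEST FRAMING (LADDER-GRIDFUSION three columns; CF rung; successor step of «q′(ψ_N = 1/2) on the CF rung», F2-SCOPING v1.6 §10(c)).  One `decide +kernel`
(≈ 110 s): for each listed panel the obligation `CFIterLike.QHalfShear.ShearCert.ok` (`Models/CerfonFreidbergIterLikeQHalfShearDefs.lean`) — the Taylor-model run of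
`progQ = CFIterLike.QHalf.progA ++ blockQ` over ★ #117's parameter box is ACCEPTED and the kernel's panel-integral enclosure of the shear kernel `K·p` along the
approximant lies inside the claimed integers (read off a compiled `#eval` of the same functions, slack one unit of `2⁻⁶⁰`; float truth inside every panel).
MODELLED: analytic Cerfon–Freidberg family; nothing about a device or stability.  No `native_decide`.  Typer/prover: gridfusion-model-5 (g8), 2026-08-27.
Citations: Freidberg 2014 §6.3.5 (6.35) [Freidberg2014]; Mahboubi–Melquiond–Sibut-Pinote 2016 §3.2 Lemma 3 [MahboubiMelquiondSibutpinote2016].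
-/

namespace Summit.Ventures.FusionMHD.Models.CFIterLike.QHalfShear

/-- Shear-register certificate data of panels 0, 1. [instance data] -/
def shearCert1 : List ShearCert := [
  { j := 0, cand := [94661745770447339520, 20300713460575428608, 652310595854434566144, 172326083280062447616, 2781981305684470267904, 953911900309397700608, 10304997718563481452544, 3206462384168009990144, 167033857388417669660672, 3532239230908900036313088, -320090681416286845567762432, -4697942099670322203531935744, 246429299941212217602356543488],
    deg := 12, elog2 := 42, plo := -884583076289545262, phi := -884582934181694007 },
  { j := 1, cand := [95941115408989028352, 61921015120728711168, 685209230057787228160, 535893126104702582784, 3089244632611704274944, 3040003000504731828224, 12277496457252078354432, 11801908151226877345792, 2434351252765965025280, 7349826291278836567900160, 169661101115679995668201472, -9254086214289254499873718272, -262072683486954066977860091904],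
    deg := 12, elog2 := 41, plo := -897467022977419284, phi := -897466952213136803 }]

/-- **KERNEL CHECK** of the shear register on panels 0, 1. -/
theorem shearCert1_ok : CFIterLike.QHalfShear.shearCert1.all ShearCert.ok = true := by
  decide +kernel

end Summit.Ventures.FusionMHD.Models.CFIterLike.QHalfShear
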